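import Mathlib
import Summits.Ventures.PercRepro2.Tail2DBlockCalc
import Summits.Ventures.PercRepro2.Tail2DHarrisSP
import Summits.Ventures.PercRepro2.Tail2DFlowOneBlocks
import Summits.Ventures.PercRepro2.Tail2DFlowOnePar
import Summits.Ventures.PercRepro2.Tail2DSDomSwap
import Summits.Ventures.PercRepro2.Tail2DFlowOneStep01
import Summits.Ventures.PercRepro2.Tail2DFlowOneThreeCounts
import Summits.Ventures.PercRepro2.Tail2DRelayBlocks
import Summits.Ventures.PercRepro2.Tail2DRelayU0Weights
import Summits.Ventures.PercRepro2.Tail2DRelayU0Blocks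

/-!
# The one-factor relay step of (SD) at `(u,0)`, `u ≥ 2`, conditional on three count inequalities
(seat mine-b, cell pub-perc-repro2; conjectures/MINE-B.md §45.8)

On `Z = X ∥ Y` with `X` flow-one, `E(u,0) = R × E_Y(u−1,0) ⊔ col × E_Y(u,0)` and
`E(u−1,1) = R × E_Y(u−2,1) ⊔ B × E_Y(u−1,0) ⊔ C × E_Y(u−1,1)`.  Seven product moves — the whole `R`-part is shifted
by (SD) of `Y` at `(u−1,0)` or flipped, its row-tail part `R × D_Y(u−1,0)` (`rowTailAt`) flips, its `E_Y(u−1,1)` part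
relaxes, the `B`-part moves by (SD) of `Y` at `(u,0)` or by the red axis, the `C`-part by (SD) of `Y` at `(u,0)` —
with the FORCED weights `relayU0W` in the atoms `a = #R_X`, `c = #C_X`, `P = T_Y(u,0)`, `Q = T_Y(u−1,0)`,
`S = T_Y(u−1,1)`, `U = T_Y(u−2,1)`.  They are non-negative iff
(I) `P (Q + U) ≤ S (P + Q)` (independent of `X`; at `u = 2` it is `Δ ≥ 0` of `Tail2DRelay20`),
(II) `c Q S ≤ (a + c) P (U + Q)` and (III) `S #E ((a+c) Q + a U) ≤ Q (a S + (a+c) P) #E'`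
(`relayU0W_nonneg`); `sdomZ_par_relay_u0` is the step under these hypotheses.  Census (mining/mine-b/code/g43/
relayu0_conds.py): (I) holds on every comb instance tested (X-free), (II) and (III) hold whenever the peeled factor
has the minimum `γ = c/a` (0 / 180) and fail for a C-heavy peeled factor (17 / 180) — the inductive proof of the
three inequalities along a comb is the open item.
-/

namespace Summit.Ventures.PercRepro2.Tail2D

open V2Closure Finset


section StepU0

variable (X Y : V2Closure.SP) (m : ℕ)

/-- the `X`-blocks of the seven source moves -/
def relayU0SrcX : Fin 7 → Finset X.Conf := ![rSet X, rSet X, rSet X, rSet X, bSet X, bSet X, cellSet X]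
/-- the `X`-blocks of the seven target moves -/
def relayU0TgtX : Fin 7 → Finset X.Conf := ![rSet X, bSet X, bSet X, colSet X, bSet X, bSet X, cellSet X]
/-- the `Y`-blocks of the seven source moves (position `(m+2, 0)`) -/
def relayU0SrcY : Fin 7 → Finset Y.Conf :=
  ![tailSet Y (m + 1) 0, tailSet Y (m + 1) 0, rowTailAt Y (m + 1), tailSet Y (m + 1) 1, tailSet Y (m + 2) 0,
    tailSet Y (m + 2) 0, tailSet Y (m + 2) 0]
/-- the `Y`-blocks of the seven target moves -/
def relayU0TgtY : Fin 7 → Finset Y.Conf :=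
  ![tailSet Y m 1, tailSet Y (m + 1) 0, rowTailAt Y (m + 1), tailSet Y (m + 1) 1, tailSet Y (m + 1) 1,
    tailSet Y (m + 1) 0, tailSet Y (m + 1) 1]
/-- the weights in the counts of `X` and `Y` -/
def relayU0WXY : Fin 7 → ℚ :=
  relayU0W ((rSet X).card) ((cellSet X).card) (tailCount Y (m + 2) 0) (tailCount Y (m + 1) 0)
    (tailCount Y (m + 1) 1) (tailCount Y m 1)

/-- the rational facts shared by the coverage identities -/
theorem relayU0_facts (hX : FlowOne X) (ha : 0 < (rSet X).card) (hP : 0 < tailCount Y (m + 2) 0)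
    (hS : 0 < tailCount Y (m + 1) 1) :
    ((rSet X).card : ℚ) ≠ 0 ∧ (tailCount Y (m + 2) 0 : ℚ) ≠ 0 ∧ (tailCount Y (m + 1) 0 : ℚ) ≠ 0 ∧
    (tailCount Y (m + 1) 1 : ℚ) ≠ 0 ∧ ((cellSet X).card : ℚ) + (rSet X).card ≠ 0 ∧
    relayU0E ((rSet X).card) ((cellSet X).card) (tailCount Y (m + 2) 0) (tailCount Y (m + 1) 0) ≠ 0 ∧
    relayU0E' ((rSet X).card) ((cellSet X).card) (tailCount Y (m + 1) 0) (tailCount Y (m + 1) 1) (tailCount Y m 1) ≠ 0 ∧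
    ((rowTailAt Y (m + 1)).card : ℚ) = tailCount Y (m + 1) 0 - tailCount Y (m + 1) 1 ∧
    ((colSet X).card : ℚ) = (cellSet X).card + (rSet X).card ∧
    ((bSet X).card : ℚ) = (rSet X).card ∧
    (tailCount (V2Closure.SP.par X Y) (m + 2) 0 : ℚ)
      = relayU0E ((rSet X).card) ((cellSet X).card) (tailCount Y (m + 2) 0) (tailCount Y (m + 1) 0) ∧
    (tailCount (V2Closure.SP.par X Y) (m + 1) 1 : ℚ)
      = relayU0E' ((rSet X).card) ((cellSet X).card) (tailCount Y (m + 1) 0) (tailCount Y (m + 1) 1)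
          (tailCount Y m 1) := by
  have hB := card_bSet_eq X
  have hcc := card_cellSet_add X hX
  have hD := card_rowTailAt_add Y (m + 1)
  have haq : (0 : ℚ) < (rSet X).card := by exact_mod_cast ha
  have hccq : (0 : ℚ) ≤ (cellSet X).card := by positivity
  have hPq : (0 : ℚ) < tailCount Y (m + 2) 0 := by exact_mod_cast hP
  have hSq : (0 : ℚ) < tailCount Y (m + 1) 1 := by exact_mod_cast hS
  have hQ : 0 < tailCount Y (m + 1) 0 := by omega
  have hQq : (0 : ℚ) < tailCount Y (m + 1) 0 := by exact_mod_cast hQ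
  have hUq : (0 : ℚ) ≤ tailCount Y m 1 := by positivity
  refine ⟨ne_of_gt haq, ne_of_gt hPq, ne_of_gt hQq, ne_of_gt hSq, by positivity,
    ne_of_gt (relayU0E_pos haq hccq hPq hQq.le), ne_of_gt (relayU0E'_pos haq hccq hQq hSq.le hUq), ?_,
    by exact_mod_cast hcc.symm, by exact_mod_cast hB, ?_, ?_⟩
  · have : ((rowTailAt Y (m + 1)).card : ℚ) + tailCount Y (m + 1) 1 = tailCount Y (m + 1) 0 := by
      exact_mod_cast hD
    linarith
  · unfold relayU0E
    rw [tailCount_par_u0_left Y X hX m, ← card_colSet X hX, ← hcc]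
    push_cast; ring
  · unfold relayU0E'
    rw [tailCount_par_u1_left Y X hX m]
    push_cast; ring

/-- **the source coverage**: `Unif(E(m+2,0))` is the `relayU0WXY`-mixture of the source blocks -/
theorem relayU0_cov_src (hX : FlowOne X) (ha : 0 < (rSet X).card) (hP : 0 < tailCount Y (m + 2) 0)
    (hS : 0 < tailCount Y (m + 1) 1) (p : (V2Closure.SP.par X Y).Conf) :
    ∑ k, relayU0WXY X Y m k * unifDens (V2Closure.SP.par X Y) (relayU0SrcX X k ×ˢ relayU0SrcY Y m k) p
      = unifDens _ (tailSet (V2Closure.SP.par X Y) (m + 2) 0) p := by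
  obtain ⟨ha0, hP0, hQ0, hS0, -, hE0, hE'0, hDq, -, hBq, hEq, -⟩ := relayU0_facts X Y m hX ha hP hS
  obtain ⟨x, y⟩ := p
  simp only [Fin.sum_univ_succ, Fin.sum_univ_zero, relayU0SrcX, relayU0SrcY, relayU0WXY, Matrix.cons_val_zero,
    Matrix.cons_val_succ, unifDens_par_prod, unifDens_par_tail, mem_tailSet_iff, mem_rSet, mem_bSet, mem_cellSet,
    mem_rowTailAt, ← tailCount_eq_card]
  rcases flowOne_cases X hX x with hx | hx | hx
  · -- `x ∈ R`: the source needs `r_y ≥ m + 1`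
    rcases (show m + 1 ≤ Y.rLab y ∨ ¬ (m + 1 ≤ Y.rLab y) by omega) with hr | hr
    · have hc2 : m + 2 ≤ 1 + Y.rLab y := by omega
      rcases (show 1 ≤ Y.bLab y ∨ Y.bLab y = 0 by omega) with hb | hb
      · have hb0 : Y.bLab y ≠ 0 := by omega
        simp [hx.1, hx.2, hr, hb, hb0, hc2]
        rw [hEq]
        exact relayU0_srcA ha0 hQ0 hS0 hE0 hE'0
      · have hD0 : ((rowTailAt Y (m + 1)).card : ℚ) ≠ 0 := by
          have : 0 < (rowTailAt Y (m + 1)).card := Finset.card_pos.2 ⟨y, (mem_rowTailAt Y (m + 1) y).2 ⟨hr, hb⟩⟩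
          exact_mod_cast ne_of_gt this
        have hQS0 : (tailCount Y (m + 1) 0 : ℚ) - tailCount Y (m + 1) 1 ≠ 0 := by rw [← hDq]; exact hD0
        simp [hx.1, hx.2, hr, hb, hc2]
        rw [hEq, hDq]
        exact relayU0_srcD ha0 hQ0 hS0 hQS0 hE0 hE'0
    · have hc2 : ¬ (m + 2 ≤ 1 + Y.rLab y) := by omega
      simp [hx.1, hx.2, hr, hc2]
  · -- `x ∈ B`: the source needs `r_y ≥ m + 2`
    rcases (show m + 2 ≤ Y.rLab y ∨ ¬ (m + 2 ≤ Y.rLab y) by omega) with hr | hr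
    · simp [hx.1, hx.2, hr]
      rw [hEq, hBq]
      exact relayU0_srcB ha0 hP0 hE0 hE'0
    · simp [hx.1, hx.2, hr]
  · -- `x ∈ C`: the source needs `r_y ≥ m + 2`
    have hcc0 : ((cellSet X).card : ℚ) ≠ 0 := by
      have : 0 < (cellSet X).card := Finset.card_pos.2 ⟨x, (mem_cellSet X x).2 hx⟩
      exact_mod_cast ne_of_gt this
    rcases (show m + 2 ≤ Y.rLab y ∨ ¬ (m + 2 ≤ Y.rLab y) by omega) with hr | hr
    · simp [hx.1, hx.2, hr]
      rw [hEq]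
      exact relayU0_srcC hcc0 hP0 hE0
    · simp [hx.1, hx.2, hr]

/-- **the target coverage**: `Unif(E(m+1,1))` is the `relayU0WXY`-mixture of the target blocks -/
theorem relayU0_cov_tgt (hX : FlowOne X) (ha : 0 < (rSet X).card) (hP : 0 < tailCount Y (m + 2) 0)
    (hS : 0 < tailCount Y (m + 1) 1) (p : (V2Closure.SP.par X Y).Conf) :
    ∑ k, relayU0WXY X Y m k * unifDens (V2Closure.SP.par X Y) (relayU0TgtX X k ×ˢ relayU0TgtY Y m k) p
      = unifDens _ (tailSet (V2Closure.SP.par X Y) (m + 1) 1) p := by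
  obtain ⟨ha0, hP0, hQ0, hS0, hca0, hE0, hE'0, hDq, hColq, hBq, -, hE'q⟩ := relayU0_facts X Y m hX ha hP hS
  obtain ⟨x, y⟩ := p
  simp only [Fin.sum_univ_succ, Fin.sum_univ_zero, relayU0TgtX, relayU0TgtY, relayU0WXY, Matrix.cons_val_zero,
    Matrix.cons_val_succ, unifDens_par_prod, unifDens_par_tail, mem_tailSet_iff, mem_rSet, mem_bSet, mem_cellSet,
    mem_colSet, mem_rowTailAt, ← tailCount_eq_card]
  rcases flowOne_cases X hX x with hx | hx | hx
  · -- `x ∈ R`: the target needs `r_y ≥ m` and `b_y ≥ 1`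
    rcases (show (m ≤ Y.rLab y ∧ 1 ≤ Y.bLab y) ∨ ¬ (m ≤ Y.rLab y ∧ 1 ≤ Y.bLab y) by tauto) with h | h
    · have hU0 : (tailCount Y m 1 : ℚ) ≠ 0 := by
        have : 0 < tailCount Y m 1 := by
          rw [tailCount_eq_card]
          exact Finset.card_pos.2 ⟨y, (mem_tailSet_iff Y m 1 y).2 h⟩
        exact_mod_cast ne_of_gt this
      have hc1 : m + 1 ≤ 1 + Y.rLab y := by omega
      simp [hx.1, hx.2, h.1, h.2, hc1]
      rw [hE'q]
      exact relayU0_tgtR ha0 hU0 hE'0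
    · rcases (show ¬ (m ≤ Y.rLab y) ∨ ¬ (1 ≤ Y.bLab y) by tauto) with h1 | h1
      · have h1' : ¬ (m < 1 + Y.rLab y) := by omega
        simp [hx.1, hx.2, h1, h1']
      · simp [hx.1, hx.2, h1]
  · -- `x ∈ B`: the target needs `r_y ≥ m + 1`
    rcases (show m + 1 ≤ Y.rLab y ∨ ¬ (m + 1 ≤ Y.rLab y) by omega) with hr | hr
    · rcases (show 1 ≤ Y.bLab y ∨ Y.bLab y = 0 by omega) with hb | hb
      · have hb0 : Y.bLab y ≠ 0 := by omega
        simp [hx.1, hx.2, hr, hb, hb0]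
        rw [hE'q, hBq, hColq]
        exact relayU0_tgtB1 ha0 hca0 hQ0 hS0 hE0 hE'0
      · have hD0 : ((rowTailAt Y (m + 1)).card : ℚ) ≠ 0 := by
          have : 0 < (rowTailAt Y (m + 1)).card := Finset.card_pos.2 ⟨y, (mem_rowTailAt Y (m + 1) y).2 ⟨hr, hb⟩⟩
          exact_mod_cast ne_of_gt this
        have hQS0 : (tailCount Y (m + 1) 0 : ℚ) - tailCount Y (m + 1) 1 ≠ 0 := by rw [← hDq]; exact hD0
        simp [hx.1, hx.2, hr, hb]
        rw [hE'q, hBq, hDq]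
        exact relayU0_tgtB2 ha0 hQ0 hS0 hQS0 hE0 hE'0
    · simp [hx.1, hx.2, hr]
  · -- `x ∈ C`: the target needs `r_y ≥ m + 1` and `b_y ≥ 1`
    have hcc0 : ((cellSet X).card : ℚ) ≠ 0 := by
      have : 0 < (cellSet X).card := Finset.card_pos.2 ⟨x, (mem_cellSet X x).2 hx⟩
      exact_mod_cast ne_of_gt this
    rcases (show (m + 1 ≤ Y.rLab y ∧ 1 ≤ Y.bLab y) ∨ ¬ (m + 1 ≤ Y.rLab y ∧ 1 ≤ Y.bLab y) by tauto) with h | h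
    · simp [hx.1, hx.2, h.1, h.2]
      rw [hE'q, hColq]
      exact relayU0_tgtC hcc0 hca0 hS0 hE0 hE'0
    · rcases (show ¬ (m + 1 ≤ Y.rLab y) ∨ ¬ (1 ≤ Y.bLab y) by tauto) with h1 | h1
      · simp [hx.1, hx.2, h1]
      · simp [hx.1, hx.2, h1]

/-- the `X`-dominations of the seven moves -/
theorem relayU0_domX : ∀ k, BlockDom X (relayU0SrcX X k) (relayU0TgtX X k) := by
  intro k; fin_cases k
  · show BlockDom X (rSet X) (rSet X); exact blockDom_refl X _
  · show BlockDom X (rSet X) (bSet X); exact dom_r_b X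
  · show BlockDom X (rSet X) (bSet X); exact dom_r_b X
  · show BlockDom X (rSet X) (colSet X); exact dom_r_col X
  · show BlockDom X (bSet X) (bSet X); exact blockDom_refl X _
  · show BlockDom X (bSet X) (bSet X); exact blockDom_refl X _
  · show BlockDom X (cellSet X) (cellSet X); exact blockDom_refl X _

/-- the `Y`-dominations of the seven moves: (SD) at `(m+1,0)`, identities, (SD) at `(m+2,0)`, the red axis -/
theorem relayU0_domY (hY1 : BlockDom Y (tailSet Y (m + 1) 0) (tailSet Y m 1))
    (hY2 : BlockDom Y (tailSet Y (m + 2) 0) (tailSet Y (m + 1) 1))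
    (hYax : BlockDom Y (tailSet Y (m + 2) 0) (tailSet Y (m + 1) 0)) :
    ∀ k, BlockDom Y (relayU0SrcY Y m k) (relayU0TgtY Y m k) := by
  intro k; fin_cases k
  · show BlockDom Y (tailSet Y (m + 1) 0) (tailSet Y m 1); exact hY1
  · show BlockDom Y (tailSet Y (m + 1) 0) (tailSet Y (m + 1) 0); exact blockDom_refl Y _
  · show BlockDom Y (rowTailAt Y (m + 1)) (rowTailAt Y (m + 1)); exact blockDom_refl Y _
  · show BlockDom Y (tailSet Y (m + 1) 1) (tailSet Y (m + 1) 1); exact blockDom_refl Y _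
  · show BlockDom Y (tailSet Y (m + 2) 0) (tailSet Y (m + 1) 1); exact hY2
  · show BlockDom Y (tailSet Y (m + 2) 0) (tailSet Y (m + 1) 0); exact hYax
  · show BlockDom Y (tailSet Y (m + 2) 0) (tailSet Y (m + 1) 1); exact hY2

/-- the target of every move with a non-empty source is non-empty -/
theorem relayU0_nonempty (hX : FlowOne X) (ha : 0 < (rSet X).card) (hS : 0 < tailCount Y (m + 1) 1) :
    ∀ k, 0 < relayU0WXY X Y m k → (relayU0SrcX X k ×ˢ relayU0SrcY Y m k).Nonempty →
      (relayU0TgtX X k ×ˢ relayU0TgtY Y m k).Nonempty := by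
  obtain ⟨-, -, -, -, hRne, hBne, hColne, -⟩ := counts X hX ha
  have hS' : (tailSet Y (m + 1) 1).Nonempty := by
    rw [← Finset.card_pos, ← tailCount_eq_card]; exact hS
  have hQ' : (tailSet Y (m + 1) 0).Nonempty := by
    rw [← Finset.card_pos, ← tailCount_eq_card]
    have := card_rowTailAt_add Y (m + 1); omega
  have hU' : (tailSet Y m 1).Nonempty := by
    rw [← Finset.card_pos, ← tailCount_eq_card]
    have h1 : tailCount Y (m + 1) 1 ≤ tailCount Y m 1 := by
      rw [tailCount_eq_card, tailCount_eq_card]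
      apply Finset.card_le_card
      intro y hy; rw [mem_tailSet_iff] at hy ⊢; omega
    omega
  intro k _ hne
  match k with
  | 0 =>
    show (rSet X ×ˢ tailSet Y m 1).Nonempty
    exact Finset.nonempty_product.2 ⟨hRne, hU'⟩
  | 1 =>
    show (bSet X ×ˢ tailSet Y (m + 1) 0).Nonempty
    exact Finset.nonempty_product.2 ⟨hBne, hQ'⟩
  | 2 =>
    show (bSet X ×ˢ rowTailAt Y (m + 1)).Nonempty
    have hne' : (rSet X ×ˢ rowTailAt Y (m + 1)).Nonempty := hne
    exact Finset.nonempty_product.2 ⟨hBne, (Finset.nonempty_product.1 hne').2⟩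
  | 3 =>
    show (colSet X ×ˢ tailSet Y (m + 1) 1).Nonempty
    exact Finset.nonempty_product.2 ⟨hColne, hS'⟩
  | 4 =>
    show (bSet X ×ˢ tailSet Y (m + 1) 1).Nonempty
    exact Finset.nonempty_product.2 ⟨hBne, hS'⟩
  | 5 =>
    show (bSet X ×ˢ tailSet Y (m + 1) 0).Nonempty
    exact Finset.nonempty_product.2 ⟨hBne, hQ'⟩
  | 6 =>
    show (cellSet X ×ˢ tailSet Y (m + 1) 1).Nonempty
    have hne' : (cellSet X ×ˢ tailSet Y (m + 2) 0).Nonempty := hne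
    exact Finset.nonempty_product.2 ⟨(Finset.nonempty_product.1 hne').1, hS'⟩

/-- the weights are non-negative under the three count inequalities -/
theorem relayU0_weights_nonneg (ha : 0 < (rSet X).card) (hP : 0 < tailCount Y (m + 2) 0)
    (hS : 0 < tailCount Y (m + 1) 1)
    (hI : tailCount Y (m + 2) 0 * (tailCount Y (m + 1) 0 + tailCount Y m 1)
      ≤ tailCount Y (m + 1) 1 * (tailCount Y (m + 2) 0 + tailCount Y (m + 1) 0))
    (hII : (cellSet X).card * tailCount Y (m + 1) 0 * tailCount Y (m + 1) 1
      ≤ ((rSet X).card + (cellSet X).card) * tailCount Y (m + 2) 0 * (tailCount Y m 1 + tailCount Y (m + 1) 0))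
    (hIII : tailCount Y (m + 1) 1 * ((rSet X).card * tailCount Y (m + 1) 0
          + ((rSet X).card + (cellSet X).card) * tailCount Y (m + 2) 0)
        * (((rSet X).card + (cellSet X).card) * tailCount Y (m + 1) 0 + (rSet X).card * tailCount Y m 1)
      ≤ tailCount Y (m + 1) 0 * ((rSet X).card * tailCount Y (m + 1) 1
          + ((rSet X).card + (cellSet X).card) * tailCount Y (m + 2) 0)
        * ((rSet X).card * tailCount Y m 1 + (rSet X).card * tailCount Y (m + 1) 0
          + (cellSet X).card * tailCount Y (m + 1) 1)) :
    ∀ k, 0 ≤ relayU0WXY X Y m k := by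
  have hD := card_rowTailAt_add Y (m + 1)
  have haq : (0 : ℚ) < (rSet X).card := by exact_mod_cast ha
  have hccq : (0 : ℚ) ≤ (cellSet X).card := by positivity
  have hPq : (0 : ℚ) < tailCount Y (m + 2) 0 := by exact_mod_cast hP
  have hSq : (0 : ℚ) < tailCount Y (m + 1) 1 := by exact_mod_cast hS
  have hQ : 0 < tailCount Y (m + 1) 0 := by omega
  have hQq : (0 : ℚ) < tailCount Y (m + 1) 0 := by exact_mod_cast hQ
  have hUq : (0 : ℚ) ≤ tailCount Y m 1 := by positivity
  have hSQq : (tailCount Y (m + 1) 1 : ℚ) ≤ tailCount Y (m + 1) 0 := by exact_mod_cast (by omega : tailCount Y (m + 1) 1 ≤ tailCount Y (m + 1) 0)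
  have hIq : (tailCount Y (m + 2) 0 : ℚ) * (tailCount Y (m + 1) 0 + tailCount Y m 1)
      ≤ tailCount Y (m + 1) 1 * (tailCount Y (m + 2) 0 + tailCount Y (m + 1) 0) := by exact_mod_cast hI
  have hIIq : ((cellSet X).card : ℚ) * tailCount Y (m + 1) 0 * tailCount Y (m + 1) 1
      ≤ ((rSet X).card + (cellSet X).card) * tailCount Y (m + 2) 0 * (tailCount Y m 1 + tailCount Y (m + 1) 0) := by
    exact_mod_cast hII
  have hIIIq : (tailCount Y (m + 1) 1 : ℚ) * relayU0E ((rSet X).card) ((cellSet X).card) (tailCount Y (m + 2) 0)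
        (tailCount Y (m + 1) 0) * (((rSet X).card + (cellSet X).card) * tailCount Y (m + 1) 0 + (rSet X).card * tailCount Y m 1)
      ≤ tailCount Y (m + 1) 0 * ((rSet X).card * tailCount Y (m + 1) 1
          + ((rSet X).card + (cellSet X).card) * tailCount Y (m + 2) 0)
        * relayU0E' ((rSet X).card) ((cellSet X).card) (tailCount Y (m + 1) 0) (tailCount Y (m + 1) 1) (tailCount Y m 1) := by
    unfold relayU0E relayU0E'; exact_mod_cast hIII
  exact relayU0W_nonneg haq hccq hPq hQq hSq hUq hSQq hIq hIIq hIIIq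

/-- **the one-factor relay step of (SD) at `(m+2, 0)`**, conditional on the three count inequalities (I), (II),
(III) of `Y` and `X`: from (SD) of `Y` at `(m+1,0)` and `(m+2,0)` and the red axis at `(m+2,0)` -/
theorem sdomZ_par_relay_u0 (hX : FlowOne X) (ha : 0 < (rSet X).card)
    (hY1 : SDomZ Y ((m : ℤ) + 1) 0) (hY2 : SDomZ Y ((m : ℤ) + 2) 0) (hYax : SDomZ Y ((m : ℤ) + 2) (-1))
    (hP : 0 < tailCount Y (m + 2) 0) (hS : 0 < tailCount Y (m + 1) 1)
    (hI : tailCount Y (m + 2) 0 * (tailCount Y (m + 1) 0 + tailCount Y m 1)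
      ≤ tailCount Y (m + 1) 1 * (tailCount Y (m + 2) 0 + tailCount Y (m + 1) 0))
    (hII : (cellSet X).card * tailCount Y (m + 1) 0 * tailCount Y (m + 1) 1
      ≤ ((rSet X).card + (cellSet X).card) * tailCount Y (m + 2) 0 * (tailCount Y m 1 + tailCount Y (m + 1) 0))
    (hIII : tailCount Y (m + 1) 1 * ((rSet X).card * tailCount Y (m + 1) 0
          + ((rSet X).card + (cellSet X).card) * tailCount Y (m + 2) 0)
        * (((rSet X).card + (cellSet X).card) * tailCount Y (m + 1) 0 + (rSet X).card * tailCount Y m 1)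
      ≤ tailCount Y (m + 1) 0 * ((rSet X).card * tailCount Y (m + 1) 1
          + ((rSet X).card + (cellSet X).card) * tailCount Y (m + 2) 0)
        * ((rSet X).card * tailCount Y m 1 + (rSet X).card * tailCount Y (m + 1) 0
          + (cellSet X).card * tailCount Y (m + 1) 1)) :
    SDomZ (V2Closure.SP.par X Y) ((m : ℤ) + 2) 0 := by
  rw [sdomZ_iff_blockDom] at hY1 hY2 hYax ⊢
  have e1 : ((m : ℤ) + 2).toNat = m + 2 := by omega
  have e2 : ((0 : ℤ)).toNat = 0 := rfl
  have e3 : ((m : ℤ) + 2 - 1).toNat = m + 1 := by omega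
  have e4 : ((0 : ℤ) + 1).toNat = 1 := rfl
  have e5 : ((m : ℤ) + 1).toNat = m + 1 := by omega
  have e6 : ((m : ℤ) + 1 - 1).toNat = m := by omega
  have e7 : ((-1 : ℤ)).toNat = 0 := rfl
  have e8 : ((-1 : ℤ) + 1).toNat = 0 := rfl
  rw [e1, e2, e3, e4] at hY2 ⊢
  rw [e5, e2, e6, e4] at hY1
  rw [e1, e7, e3, e8] at hYax
  exact blockDom_par_of_certificate X Y (relayU0SrcX X) (relayU0TgtX X) (relayU0SrcY Y m) (relayU0TgtY Y m)
    (relayU0WXY X Y m) (relayU0_weights_nonneg X Y m ha hP hS hI hII hIII) (relayU0_domX X)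
    (relayU0_domY Y m hY1 hY2 hYax) (relayU0_nonempty X Y m hX ha hS) _ _
    (relayU0_cov_src X Y m hX ha hP hS) (relayU0_cov_tgt X Y m hX ha hP hS)

end StepU0

end Summit.Ventures.PercRepro2.Tail2D
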